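import Summits.CriticalPhenomena.Ising3DConformalLimit.Theses.ModularBoosts
import Summits.CriticalPhenomena.Ising3DConformalLimit.Theorems.MonotoneBlockingLimitsAreConformalSummit
import Summits.CriticalPhenomena.Ising3DConformalLimit.Theorems.ModularBoostsLimitRotationInvariance
import Summits.CriticalPhenomena.Ising3DConformalLimit.Theorems.HyperoctahedralRPLimitRotationInvariant
import HarnessLib

/-!
# Redirect audit of crux `IsingLimitLightCone` (stmt-CriticalPhenomena-5430), route `ModularBoosts`

Crux-strategist REDIRECT r1 (`planner-cstrat-stmt-CriticalPhenomena-5430-r1-0`, 2026-08-17).  Kernel-checked facts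
behind the verdict in `STRATEGY-CENSUS.md` (same crux directory).  No definitions, no `sorry`; everything is a
one-line assembly over LANDED theorems of the tree.

* §1 `summit_iff_hubs`, `closes_without_lightCone` — the sub-problem `Ising3DConformalLimit` is EXACTLY the
  conjunction of the route's three shared hub items (C) `ExistsScaleCovariantLimit` (stmt-1981),
  (D) `InversionUpgradeNormalised` (stmt-1982), (E) `IsingEuclidUpgradeR4NonGaussian` (stmt-0636) — this route's
  spellings are the same terms as `HyperoctahedralRP`'s, and the tree theorem
  `Theorems.LimitsAreConformalSummit.summit_iff_three_hubs` applies verbatim.  Hence the route's deciding theorem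
  `ModularBoosts.closes (hL) (hM) (hC) (hD) (hE) (hV) (hB)` consumes `hL : IsingLimitLightCone`,
  `hM : ModularBoostIsotropy`, `hV`, `hB` only DECORATIVELY: `closes_without_lightCone hC hD hE` reaches the
  Statement without them.  The route minus its ornaments is the summit (RESTATED at route level).
* §2 `limitRotationInvariance_holds` — the route's milestone `LimitRotationInvariance` (item stmt-5434, listed open)
  is a THEOREM of the tree: `HyperoctahedralRP.LimitRotationInvariant` (stmt-1980) was closed `proved` on
  2026-08-16 (`…QuarterTurnLiouville.LimitRotationInvariant_of`, with `HRP2Rigidity_of`, stmt-1979), and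
  `ModularBoostsRotation.limitRotationInvariance_of_hyperoctahedral` transports it.  So the ONLY use of (L) in the
  route — producing `O(3)` invariance through (M)+(V)+(B₃) — is pre-empted by the tree.
* §3 `modularBoostIsotropy_holds` — crux (M) `ModularBoostIsotropy` (stmt-5431, rank 3, "XL") holds OUTRIGHT with
  `c = 1`, its light-cone hypotheses (a), (b) and the speed `v` being unused: a linear map preserving
  `x₀² + x₁² + x₂²` is a linear isometry, and every limit in question is `O(3)`-invariant by §2.
* §4 `isingLimitLightCone_iff_forall_imp` — bookkeeping: (L) is a statement about limits only; it is vacuous unless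
  a limit as in (C) exists, and it does not mention inversion (D) or `U₄` (E); see the census for why it is
  strictly weaker than the Statement and why it is nevertheless not on any path to it.

References: J. Glimm, A. Jaffe, *Quantum Physics* (2nd ed. 1987), §19.5 (Thm 19.5.1, Cor 19.5.4, Thm 19.5.5,
Prop 19.5.7) and §19.6; H. Duminil-Copin, Proc. ICM 2022, §8.1, §8.4.
-/

noncomputable section

namespace Summit.CriticalPhenomena.Ising3DConformalLimit.Cruxes.IsingLimitLightCone.RedirectAudit

open Literature.Probability.LatticeModels
open Summit.CriticalPhenomena.Ising3DConformalLimit.Theses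

/-! ## §1 The route's hubs are exactly the sub-problem; (L), (M), (V), (B₃) are not load-bearing -/

/-- **`Ising3DConformalLimit ↔ (C) ∧ (D) ∧ (E)`** in the `ModularBoosts` spellings (the decls have the same bodies
as the `HyperoctahedralRP` hub items stmt-1981 / stmt-1982 / stmt-0636; the tree theorem
`summit_iff_three_hubs` is accepted at this type by definitional unfolding). -/
theorem summit_iff_hubs :
    _root_.Ising3DConformalLimit ↔
      (ModularBoosts.ExistsScaleCovariantLimit ∧ ModularBoosts.InversionUpgradeNormalised ∧
        ModularBoosts.IsingEuclidUpgradeR4NonGaussian) :=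
  Theorems.LimitsAreConformalSummit.summit_iff_three_hubs

/-- **The deciding theorem without its ornaments.**  (C), (D), (E) alone give the Statement; the binders
`hL : IsingLimitLightCone`, `hM : ModularBoostIsotropy`, `hV : EllipsoidToSphere`, `hB : IsingLimitAxisPermutation`
of `ModularBoosts.closes` are logically redundant. -/
theorem closes_without_lightCone (hC : ModularBoosts.ExistsScaleCovariantLimit)
    (hD : ModularBoosts.InversionUpgradeNormalised) (hE : ModularBoosts.IsingEuclidUpgradeR4NonGaussian) :
    _root_.Ising3DConformalLimit :=
  summit_iff_hubs.2 ⟨hC, hD, hE⟩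

/-- Conversely each hub is NECESSARY: the Statement returns (C), (D), (E) (so none of them is an ornament). -/
theorem hubs_of_summit (h : _root_.Ising3DConformalLimit) :
    ModularBoosts.ExistsScaleCovariantLimit ∧ ModularBoosts.InversionUpgradeNormalised ∧
      ModularBoosts.IsingEuclidUpgradeR4NonGaussian :=
  summit_iff_hubs.1 h

/-! ## §2 The milestone `LimitRotationInvariance` (item stmt-5434) is a theorem of the tree -/

/-- **Item stmt-CriticalPhenomena-5434 holds**: every normalised, non-degenerate, translation-invariant,
scale-covariant pointwise scaling limit of `criticalCorr 3` is `O(3)`-invariant — `HyperoctahedralRP.LimitRotationInvariant`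
(stmt-1980, closed `proved` 2026-08-16 by `LimitRotationInvariant_of`) transported by
`limitRotationInvariance_of_hyperoctahedral` (which discharges `HRP2Rigidity` by `HRP2Rigidity_of`). -/
theorem limitRotationInvariance_holds : ModularBoosts.LimitRotationInvariance :=
  ModularBoostsRotation.limitRotationInvariance_of_hyperoctahedral
    Cruxes.LimitRotationInvariant.QuarterTurnLiouville.LimitRotationInvariant_of

/-! ## §3 Crux (M) `ModularBoostIsotropy` (item stmt-5431) holds outright, with `c = 1` -/

/-- A linear endomorphism of `ℝ³` preserving `x₀² + x₁² + 1²·x₂²` preserves the Euclidean norm. -/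
theorem norm_map_of_preserves_Q1 (A : EuclideanSpace ℝ (Fin 3) →ₗ[ℝ] EuclideanSpace ℝ (Fin 3))
    (hA : ∀ z : EuclideanSpace ℝ (Fin 3),
      (A z) 0 ^ 2 + (A z) 1 ^ 2 + (1:ℝ) ^ 2 * (A z) 2 ^ 2 = z 0 ^ 2 + z 1 ^ 2 + (1:ℝ) ^ 2 * z 2 ^ 2)
    (z : EuclideanSpace ℝ (Fin 3)) : ‖A z‖ = ‖z‖ := by
  have hnormsq : ∀ w : EuclideanSpace ℝ (Fin 3), w 0 ^ 2 + w 1 ^ 2 + w 2 ^ 2 = ‖w‖ ^ 2 :=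
    fun w => by rw [EuclideanSpace.real_norm_sq_eq, Fin.sum_univ_three]
  have h := hA z
  simp only [one_pow, one_mul] at h
  rw [hnormsq, hnormsq] at h
  exact (pow_left_inj₀ (norm_nonneg _) (norm_nonneg _) two_ne_zero).1 h

/-- **Item stmt-CriticalPhenomena-5431 holds.**  For every limit as in the crux and EVERY `v > 0`, clauses (a), (b)
or not, there is `c > 0` (namely `c = 1`) such that `S` is invariant under every linear map preserving
`x₀² + x₁² + c² x₂²`: such a map is a linear isometry of `ℝ³`, and `S` is `O(3)`-invariant by §2.  The light-cone
hypotheses `(a)`, `(b)` and `0 < v` are NOT used (underscored binders). -/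
theorem modularBoostIsotropy_holds : ModularBoosts.ModularBoostIsotropy := by
  intro ρ Δ v S hρ hlim hnorm hnd htr hsc _hv _ha _hb
  have hrot : IsRotationInvariant S := limitRotationInvariance_holds ρ Δ S hρ hlim hnorm hnd htr hsc
  refine ⟨1, one_pos, ?_⟩
  intro n A hA x
  let L : EuclideanSpace ℝ (Fin 3) →ₗᵢ[ℝ] EuclideanSpace ℝ (Fin 3) := ⟨A, norm_map_of_preserves_Q1 A hA⟩
  let R : EuclideanSpace ℝ (Fin 3) ≃ₗᵢ[ℝ] EuclideanSpace ℝ (Fin 3) := L.toLinearIsometryEquiv rfl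
  have hR : ∀ z, R z = A z := fun z => by
    simp [R, L]
  have h := hrot n R x
  have hcfg : (fun i => R (x i)) = fun i => A (x i) := funext fun i => hR (x i)
  rw [hcfg] at h
  exact h

/-! ## §4 Bookkeeping: the shape of (L) -/

/-- (L) is, by `intro`/`revert`, the statement "for every candidate limit `(ρ, Δ, S)` satisfying the six crux
hypotheses, the light cone (a) ∧ (b) at some speed" — a universally quantified CONDITIONAL on limits: without a
limit (item (C)) it asserts nothing, and it mentions neither inversion covariance (D) nor `U₄` (E).  Recorded as the
trivial equivalence with its curried form over `QuarterTurnLiouville.CruxHyp`. -/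
theorem isingLimitLightCone_iff_forall_imp :
    ModularBoosts.IsingLimitLightCone ↔
      ∀ (ρ : ℝ → ℝ) (Δ : ℝ) (S : CorrFamily 3),
        Cruxes.LimitRotationInvariant.QuarterTurnLiouville.CruxHyp ρ Δ S →
        ∃ v : ℝ, 0 < v ∧
          (∀ (n : ℕ) (p q : EuclideanSpace ℝ (Fin 3)) (x : Fin n → EuclideanSpace ℝ (Fin 3)) (R : ℝ),
            0 < R → q ≠ 0 → q 2 = 0 → (∀ i, R < |x i 2 - p 2|) →
            Matrix.vecCons (p + q) (Matrix.vecCons p x) ∈ NonCoincident 3 (n + 1 + 1) →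
            ∃ Φ : ℂ → ℂ, DifferentiableOn ℂ Φ {ζ : ℂ | |ζ.re| < R ∧ (ζ.re ≠ 0 ∨ |ζ.im| < ‖q‖ / v)} ∧
              ∀ s : ℝ, |s| < R → Φ (s : ℂ) =
                (S (n + 1 + 1) (Matrix.vecCons (p + q + s • EuclideanSpace.single 2 (1:ℝ))
                  (Matrix.vecCons p x)) : ℂ)) ∧
          (∀ (m k : ℕ) (x : Fin m → EuclideanSpace ℝ (Fin 3)) (y : Fin k → EuclideanSpace ℝ (Fin 3))
            (g : ℝ) (j : Fin 3), j ≠ 2 → 0 < g → (∀ a b, x a 2 + g ≤ y b 2) →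
            Fin.append x y ∈ NonCoincident 3 (m + k) →
            ∃ Φ : ℂ × ℂ → ℂ, DifferentiableOn ℂ Φ {w : ℂ × ℂ | -g < w.1.re ∧ |w.2.im| < v * (w.1.re + g)} ∧
              ∀ s b : ℝ, -g < s → Φ ((s : ℂ), (b : ℂ)) =
                (S (m + k) (Fin.append x (fun i => y i + s • EuclideanSpace.single 2 (1:ℝ) +
                  b • EuclideanSpace.single j (1:ℝ))) : ℂ)) := by
  constructor
  · intro h ρ Δ S hH
    obtain ⟨hρ, hlim, hnorm, hnd, htr, hsc⟩ := hH
    exact h ρ Δ S hρ hlim hnorm hnd htr hsc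
  · intro h ρ Δ S hρ hlim hnorm hnd htr hsc
    exact h ρ Δ S ⟨hρ, hlim, hnorm, hnd, htr, hsc⟩

end Summit.CriticalPhenomena.Ising3DConformalLimit.Cruxes.IsingLimitLightCone.RedirectAudit

end
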